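import Summits.BirchSwinnertonDyer.BirchSwinnertonDyer.Theorems.PrintCf2RamifiedOffTYZMoverBlockIndex
import Summits.BirchSwinnertonDyer.BirchSwinnertonDyer.Theorems.PrintCf2RamifiedOffTYZLevelTwoGenusPoint
import Literature.NumberTheory.EllipticCurves.Smith2016.CongruentNumberGenusDeterminantUnconditional
import Literature.NumberTheory.EllipticCurves.Smith2016.CongruentNumberMonskyDeterminantSelmer
import HarnessLib

/-!
# Crux `PrintCf2.RamifiedOffTYZOfFacts` (stmt-BirchSwinnertonDyer-20509), line `offtyz-v7`, LEAD cycle 8 (cruxlead-20509 g7):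
# PARITIES — `𝓛(n/d) mod 2 = det M_{n/d}` (Tian–Yuan–Zhang Thm 1.1 + Smith 2016 Thm 1.2 + Monsky), and `#Sel₂(E_n) = 8 ⟹ ker M_n = {0, κ_n}`
# with Monsky's non-degeneracy for `n ≡ 5 (mod 8)`

THEOREMS ONLY (no `def`, no named fact, no `sorry`), `--supports stmt-BirchSwinnertonDyer-20509`.
* §1 `card_ker_mulVec_eq_pow` (any finite index type) and **`card_ker_monsky_eq_two_of_card_selmer_eight`**: Monsky's exact formula
  `#Sel₂(E_n) = 2^{2+s(n)}` (tree theorem `monsky_card_selmerGroup_two_odd_holds`) turns `#Sel₂ = 8` into `#ker M_n = 2`, so g5's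
  `κ_n = QForm.kappa p` IS the Selmer class: `ker M_n = {0, κ_n}`, `κ_n ≠ 0`, and (`n ≡ 5 (mod 8)`, p676494) `κB ≠ 0 ∨ κA` non-constant.
* §2 **`scriptL_parity_eq_coblockWeight`**: for the data's sign choice of `𝓛`, an admissible `S ≠ univ` (`d_S ≡ 5 (mod 8)`, co-block
  `n/d_S ≡ 1 (mod 8)`): `(|𝓛(n/d_S)| mod 2) = coblockWeight p S = det M_{n/d_S}` — RELATIVE to TYZ Thm 1.1 (`thm11_parity_of_scriptL`, a named
  fact taken as hypothesis): `𝓛 ≡ Σ∏g(dᵢ) (mod 2)` (Thm 1.1), `Σ∏g odd ⟺ #Sel₂ = 4` (Smith, tree theorem), `⟺ det M = 1` (Monsky, tree theorem).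
BSD is not proved by any of this; no class is closed by this file.

References: [cite: TianYuanZhang2017, Thm. 1.1 (p0002 L90–L99), §3.1 (p0011 L73)]; [cite: Smith2016CongruentDensity, Thm. 1.2, Thm. 2.2];
[cite: HeathBrown1994SelmerCongruentII, Appendix (Monsky), typescript p. 39 L10–L33]; crux note `Lines/offtyz_v7_QForm.md` §3–§4, §11.
-/

noncomputable section

open scoped Classical NumberField

open WeierstrassCurve WeierstrassCurve.Affine Finset Matrix Literature.NumberTheory.EllipticCurves
  Literature.NumberTheory.EllipticCurves.TianYuanZhang2017
  Literature.NumberTheory.EllipticCurves.HeathBrown1994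
  Literature.NumberTheory.EllipticCurves.Smith2016
  Literature.NumberTheory.EllipticCurves.MonskySelmerParity
  Summit.BirchSwinnertonDyer.PrintCf2.QForm
  Summit.BirchSwinnertonDyer.PrintCf2.MonskyRedeiForm

set_option autoImplicit false

namespace Summit.BirchSwinnertonDyer.PrintCf2.MoverAssembly

variable {k : ℕ} (p : Fin k → ℕ) (hp : ∀ i, (p i).Prime) (hodd : ∀ i, Odd (p i)) (hinj : Function.Injective p)

/-! ## §1 `#Sel₂(E_n) = 8 ⟹ ker M_n = {0, κ_n}` -/

/-- Rank–nullity over `𝔽₂` on any finite index type: `#ker M = 2^{#ι − rank M}`. [cite: Stevenhagen1995RedeiMatrices, §2 proof of Thm. 1 (display (2))] -/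
theorem card_ker_mulVec_eq_pow {ι : Type*} [Fintype ι] [DecidableEq ι] (M : Matrix ι ι (ZMod 2)) :
    Fintype.card {v : ι → ZMod 2 // M *ᵥ v = 0} = 2 ^ (Fintype.card ι - M.rank) := by
  have hrn := LinearMap.finrank_range_add_finrank_ker M.mulVecLin
  rw [Module.finrank_fintype_fun_eq_card] at hrn
  have hker : Module.finrank (ZMod 2) (LinearMap.ker M.mulVecLin) = Fintype.card ι - M.rank := by
    rw [Matrix.rank]; omega
  have hcard : Nat.card (LinearMap.ker M.mulVecLin) = 2 ^ (Fintype.card ι - M.rank) := by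
    rw [Module.natCard_eq_pow_finrank (K := ZMod 2), Nat.card_zmod, hker]
  rw [← hcard, ← Nat.card_eq_fintype_card]
  exact Nat.card_congr (Equiv.subtypeEquivRight (q := fun v => v ∈ LinearMap.ker M.mulVecLin)
    fun v => by rw [LinearMap.mem_ker, Matrix.mulVecLin_apply])

include hp hodd hinj in
/-- **`#Sel₂(E_n) = 8 ⟹ #ker M_n = 2`** (`n = p₁⋯p_k` odd square-free): Monsky's exact formula `#Sel₂ = 2^{2+s(n)}`, `s(n) = 2k − rank M_n`,
gives `s(n) = 1`. [cite: HeathBrown1994SelmerCongruentII, Appendix (Monsky), typescript p. 38 L17 – p. 39 L33] -/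
theorem card_ker_monsky_eq_two_of_card_selmer_eight
    (hsel : Nat.card ((congruentNumberCurve (∏ i, p i)).selmerGroup 2) = 8) :
    Fintype.card {v : Fin k ⊕ Fin k → ZMod 2 // monskyMatrixOdd p *ᵥ v = 0} = 2 := by
  rw [monsky_card_selmerGroup_two_odd_holds k p hp hodd hinj, show (8 : ℕ) = 2 ^ 3 by norm_num] at hsel
  have hs : monskySelmerRankOdd p = 1 := by
    have := Nat.pow_right_injective le_rfl hsel; omega
  have hrank : (monskyMatrixOdd p).rank ≤ 2 * k := by
    have h := Matrix.rank_le_card_width (monskyMatrixOdd p)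
    rwa [Fintype.card_sum, Fintype.card_fin, ← two_mul] at h
  rw [card_ker_mulVec_eq_pow, Fintype.card_sum, Fintype.card_fin, ← two_mul]
  rw [monskySelmerRankOdd] at hs
  rw [hs, pow_one]

include hp hodd hinj in
/-- **`κ_n` IS the Selmer class**: for `#Sel₂(E_n) = 8`, `QForm.kappa p ≠ 0`, `M_n κ_n = 0`, and `ker M_n = {0, κ_n}`.
[cite: HeathBrown1994SelmerCongruentII, Appendix (Monsky), typescript p. 39 L27–L33] -/
theorem kappa_spec_of_card_selmer_eight (hsel : Nat.card ((congruentNumberCurve (∏ i, p i)).selmerGroup 2) = 8) :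
    kappa p ≠ 0 ∧ monskyMatrixOdd p *ᵥ kappa p = 0 ∧ ∀ w, monskyMatrixOdd p *ᵥ w = 0 ↔ w = 0 ∨ w = kappa p := by
  obtain ⟨h0, hker⟩ := ker_iff_of_card_eq_two (monskyMatrixOdd p) (card_ker_monsky_eq_two_of_card_selmer_eight p hp hodd hinj hsel)
  exact ⟨h0, (hker _).mpr (Or.inr rfl), hker⟩

/-- `κ = (κA; κB)` as a `Sum.elim`. [cite: HeathBrown1994SelmerCongruentII, Appendix (Monsky), typescript p. 39 L27–L33] -/
theorem sumElim_kappaA_kappaB : Sum.elim (kappaA p) (kappaB p) = kappa p := by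
  funext x; rcases x with i | i <;> rfl

include hp hodd hinj in
/-- **Non-degeneracy of the Selmer class for `n ≡ 5 (mod 8)`** (p676494 `kernel_nondegenerate_of_prod_mod_eight` applied to `κ_n`): if
`#Sel₂(E_n) = 8` then `κB ≠ 0` or `κA` is not constant. [cite: HeathBrown1994SelmerCongruentII, Appendix (Monsky), typescript p. 39 L27–L33] -/
theorem kappaB_ne_zero_or_kappaA_ne (h5 : (∏ i, p i) % 8 = 5)
    (hsel : Nat.card ((congruentNumberCurve (∏ i, p i)).selmerGroup 2) = 8) :
    kappaB p ≠ 0 ∨ ∃ i j, kappaA p i ≠ kappaA p j := by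
  obtain ⟨h0, hM, -⟩ := kappa_spec_of_card_selmer_eight p hp hodd hinj hsel
  have hp2 : ∀ i, p i ≠ 2 := ne_two_of_odd p hodd
  rw [← sumElim_kappaA_kappaB] at h0 hM
  exact kernel_nondegenerate_of_prod_mod_eight p hp hp2 h5 (kappaA p) (kappaB p) hM h0

/-! ## §2 `𝓛(n/d_S) mod 2 = coblockWeight p S` -/

/-- In `ZMod 2`, `|L|` and `L` agree. [folklore] -/
theorem natCast_natAbs_zmod_two (L : ℤ) : ((L.natAbs : ℕ) : ZMod 2) = (L : ZMod 2) := by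
  rcases Int.natAbs_eq L with h | h
  · conv_rhs => rw [h]
    simp
  · conv_rhs => rw [h]
    rw [Int.cast_neg, ZMod.neg_eq_self_mod_two]
    simp

/-- `Odd N ⟺ (N : ZMod 2) = 1`. [folklore] -/
theorem odd_iff_natCast_zmod_two_eq_one (N : ℕ) : Odd N ↔ (N : ZMod 2) = 1 := by
  rw [Nat.odd_iff, ← ZMod.natCast_mod N 2]
  constructor
  · intro h; rw [h]; rfl
  · intro h
    have hlt : N % 2 < 2 := Nat.mod_lt _ two_pos
    interval_cases hm : N % 2
    · exact absurd h (by decide)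
    · rfl

/-- A determinant over `𝔽₂` is `0` or `1`. [folklore] -/
private theorem zmod_two_eq_zero_or_eq_one (x : ZMod 2) : x = 0 ∨ x = 1 := by
  fin_cases x
  · exact Or.inl rfl
  · exact Or.inr rfl

/-- `coblockWeight p univ = 1` (the empty co-block: the determinant of the `0 × 0` Monsky matrix). [cite: Smith2016CongruentDensity, Thm. 1.2 (the empty product)] -/
theorem coblockWeight_univ : coblockWeight p (univ : Finset (Fin k)) = 1 := by
  rw [coblockWeight, coblockMonsky]
  haveI : IsEmpty (Fin (univ : Finset (Fin k))ᶜ.card ⊕ Fin (univ : Finset (Fin k))ᶜ.card) := by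
    rw [Finset.compl_univ, Finset.card_empty]; infer_instance
  exact Matrix.det_isEmpty

variable {n : ℕ} (D : GenusPointData n)

include hp hodd hinj in
/-- **`|𝓛(n/d_S)| ≡ det M_{n/d_S} (mod 2)`** for the data's sign choice `D.scriptL`, `n = p₁⋯p_k ≡ 5 (mod 8)` and an admissible `S ≠ univ`
(`d_S = ∏_{i∈S} pᵢ ≡ 5 (mod 8)`, so `m = n/d_S = ∏_{i∉S} pᵢ ≡ 1 (mod 8)`, `m > 1`), RELATIVE to Tian–Yuan–Zhang's Theorem 1.1
(`h11 : thm11_parity_of_scriptL`): `𝓛(m) ≡ Σ_{m = d₀⋯d_ℓ, dᵢ ≡ 1 (8)} ∏ g(dᵢ)` (Thm 1.1; any two sign choices of `𝓛(m)` have the same parity),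
`≡ [#Sel₂(E_m) = 4]` (Smith 2016 Thm 1.2, tree theorem), `= det M_m` (Monsky, tree theorem) `= coblockWeight p S`.
[cite: TianYuanZhang2017, Thm. 1.1 (p0002 L90–L99)] [cite: Smith2016CongruentDensity, Thm. 1.2] [cite: HeathBrown1994SelmerCongruentII, Appendix (Monsky), typescript p. 39 L27–L33] -/
theorem scriptL_parity_eq_coblockWeight (h11 : thm11_parity_of_scriptL) (hn : n = ∏ i, p i) (h5 : n % 8 = 5)
    (hLs : D.scriptLSpec) (S : Finset (Fin k)) (hS : (∏ i ∈ S, p i) % 8 = 5) (hSu : S ≠ univ) :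
    (((D.scriptL (n / ∏ i ∈ S, p i)).natAbs : ℕ) : ZMod 2) = coblockWeight p S := by
  have hp2 : ∀ i, p i ≠ 2 := ne_two_of_odd p hodd
  set m := n / ∏ i ∈ S, p i with hm
  have hmprod : m = ∏ i ∈ Sᶜ, p i := by rw [hm, hn]; exact prod_div_blockProd p hp S
  -- the co-block tuple
  set q : Fin Sᶜ.card → ℕ := blockPrimes p Sᶜ with hq
  have hqprod : ∏ t, q t = m := by rw [hmprod]; exact prod_blockPrimes p Sᶜ
  have hqp : ∀ t, (q t).Prime := blockPrimes_prime p hp Sᶜ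
  have hqodd : ∀ t, Odd (q t) := blockPrimes_odd p hodd Sᶜ
  have hqinj : Function.Injective q := blockPrimes_injective p hinj Sᶜ
  -- `m ∈ n.divisors`, `m > 1`, `m ≡ 1 (mod 8)`, `m` square-free
  have hn0 : n ≠ 0 := by rw [hn]; exact Finset.prod_ne_zero_iff.mpr fun i _ => (hp i).ne_zero
  have hdvd : m ∣ n := by rw [hmprod, hn]; exact Finset.prod_dvd_prod_of_subset _ _ _ (subset_univ _)
  have hmdiv : m ∈ n.divisors := Nat.mem_divisors.mpr ⟨hdvd, hn0⟩
  have hne : Sᶜ.Nonempty := by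
    rw [Finset.nonempty_iff_ne_empty, Ne, Finset.compl_eq_empty_iff]; exact hSu
  have hm1 : 1 < m := by
    obtain ⟨i, hi⟩ := hne
    rw [hmprod, ← Finset.mul_prod_erase _ _ hi]
    have h1 := (hp i).one_lt
    have h2 := blockProd_pos p hp (Sᶜ.erase i)
    nlinarith
  have hm8 : m % 8 = 1 := by
    have hdm : (∏ i ∈ S, p i) * m = n := by rw [hm]; exact Nat.mul_div_cancel' (by rw [hn]; exact Finset.prod_dvd_prod_of_subset _ _ _ (subset_univ S))
    have := Nat.mul_mod (∏ i ∈ S, p i) m 8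
    rw [hdm, h5, hS] at this
    have hm8' : m % 8 < 8 := Nat.mod_lt _ (by norm_num)
    interval_cases hmm : m % 8 <;> omega
  have hmsq : Squarefree m := by rw [← hqprod]; exact squarefree_prod_of_injective q hqp hqinj
  -- Thm 1.1 for `m`, read in the family `GenusField`
  obtain ⟨L, hL, hLpar⟩ := h11 m hmsq (Or.inl hm8) GenusField (isGenusFieldFamily_genusField m)
  -- the data's sign choice has the same parity
  have hLD : IsScriptL m (D.scriptL m) := hLs m hmdiv hm1
  have hpar : (((D.scriptL m).natAbs : ℕ) : ZMod 2) = (L : ZMod 2) := by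
    rw [natCast_natAbs_zmod_two]
    rcases LevelTwo.eq_or_eq_neg_of_isScriptL hLD hL with h | h
    · rw [h]
    · rw [h, Int.cast_neg, ZMod.neg_eq_self_mod_two]
  rw [hpar, hLpar]
  -- Smith + Monsky: `Σ∏g odd ⟺ #Sel₂(E_m) = 4 ⟺ det M_q = 1`
  have hiff : Odd (genusSum₁ m fun d => genusClassNumber (GenusField d)) ↔ (monskyMatrixOdd q).det = 1 := by
    rw [← hqprod, ← card_selmerGroup_two_eq_four_iff_odd_genusSum₁ q hqp hqodd hqinj (by rw [hqprod]; exact hm8),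
      card_selmerGroup_two_eq_four_iff_det_monskyMatrixOdd q hqp hqodd hqinj]
  have hcw : coblockWeight p S = (monskyMatrixOdd q).det := rfl
  rw [hcw]
  rcases zmod_two_eq_zero_or_eq_one (monskyMatrixOdd q).det with h0 | h1
  · rw [h0]
    have hno : ¬ Odd (genusSum₁ m fun d => genusClassNumber (GenusField d)) := fun ho => by
      rw [hiff, h0] at ho; exact zero_ne_one ho
    rw [odd_iff_natCast_zmod_two_eq_one] at hno
    rcases zmod_two_eq_zero_or_eq_one ((genusSum₁ m fun d => genusClassNumber (GenusField d) : ℕ) : ZMod 2) with h | h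
    · exact h
    · exact absurd h hno
  · rw [h1]
    exact (odd_iff_natCast_zmod_two_eq_one _).mp (hiff.mpr h1)

end Summit.BirchSwinnertonDyer.PrintCf2.MoverAssembly

end
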